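import Summits.BirchSwinnertonDyer.BirchSwinnertonDyer.Theorems.QuadraticBranchSignedControlPlusEtaLowerInclusionFunctionalEquationSqueezeAlgebra
import HarnessLib

/-!
# Route `QuadraticBranchSignedControl` (rung K8, cell `bsd-potss`), crux `PlusEtaLowerInclusion`
# (item stmt-BirchSwinnertonDyer-19601): the FUNCTIONAL-EQUATION SQUEEZE, part 3 — FACTORISATION-FREE:
# a UNIT `(r+2)`-nd coefficient of `L_p⁺(V,η,X)` + ONE factor of `p` on the algebraic side suffice

WHAT. Part 2 (`…FunctionalEquationSqueeze`, p619760) asked for the analytic SPLIT shape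
`Lη = u·T^r·(T−c₁)(T−c₂)` as a displayed input. THIS FILE removes the factorisation from the hypotheses:
by Weierstrass preparation in `ℤ_p⟦T⟧` (Mathlib `PowerSeries.exists_isWeierstrassFactorization`) and unique
factorisation in `ℤ_p[T]`, the only analytic input needed is

  `coeff_r Lη ≠ 0`  and  `p ∤ coeff_{r+2} Lη`      (i.e. `μ(Lη) = 0` and `λ(Lη) ≤ r + 2`),

the exact currency of the valuation squeeze's certificate `p^{v+1} ∤ coeff_r Lη` (g3, p499967) with the index
shifted by two. ALGEBRA (§1, `span_singleton_eq_of_invol_of_unitCoeff`): with `g = T^r g'`, `L = T^r M`,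
`g' ∣ M`, `p ∣ g'(0)`, `(g')` `ι`-stable (from `(g)`), `M(0) ≠ 0`, `coeff₂ M ∈ ℤ_pˣ`: Weierstrass gives
`M = P·h`, `P` distinguished of degree `≤ 2`, `h ∈ Λˣ`. Degree `0`: `g'` would be a unit — excluded by the
factor of `p`. Degree `1`: `P = T − a`, `a ∈ pℤ_p ∖ {0}`, prime and NOT `ι`-self-associate (part 1), so
`g' ~ P` is excluded by the functional equation and `g'` unit by the factor of `p` — IMPOSSIBLE (this is
WHY `λ_η − r = 1` never occurs on the census). Degree `2`: either `P` is irreducible in `ℤ_p[T]`, hence prime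
in `Λ` (tree `span_coe_isPrime_of_dvd`), and `g' ∈ {1, P}·Λˣ`, so `g' ~ P ~ M`; or `P = (T − α)(T − β)` with
`α, β ∈ pℤ_p ∖ {0}` (a reducible monic quadratic with coefficients in `𝔪` splits into linear factors with
roots in `𝔪`), and part 1's split squeeze applies. In all cases `(g) = (L)`.

The ROAD built on this brick (frame of p505261/p619760: Kobayashi 1.2/1.3/2.2η/4.1η, Kitajima–Otsuki 1.3η,
B. D. Kim 3.11η as NAMED facts + tower onto + `V`-certificate + `p ∤ coeff_{r+2} L_p⁺(V,η,T)`, `coeff_r ≠ 0`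
+ `p ∣ #(X_η/TX_η)_tors` ⟹ (E⁺_η) ∧ (C1⁺_η)) and the re-issued record of the census residue row `69150v1`
are the companion file `…PlusEtaLowerInclusionFunctionalEquationSqueezeUnitCoeff.lean` (same seat).

HONEST FRAMING (cell `bsd-potss`, run/shared/lean/pub/bsd-potss/; FULL-BSD rank ≤ 1 programme, HUMAN
RULING D-0036/D-0074): PURE ALGEBRA, unconditional; bears on crux 19601 only through the road file;
closes nothing; nothing is booked. No definition, no named fact, no `sorry`, axioms standard. Seat
`bsd-potss-k8eta-c1` (prover), g11; `--supports stmt-BirchSwinnertonDyer-19601`.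

References: [Washington1997] §7.1 Thm. 7.3 (Weierstrass preparation), §13.2; [KimBD2008MRL] Thm. 3.11 (p. 93);
[Kobayashi2003] Thm. 2.2 (p. 5), §4 + Thm. 4.1 (p. 8); [KitajimaOtsuki2018] Thm. 1.3; [MilneADT2006] I Thm. 4.10.
-/

set_option autoImplicit false
set_option linter.dupNamespace false

noncomputable section

open scoped Classical

open Literature.NumberTheory.EllipticCurves
open Literature.NumberTheory.EllipticCurves.IwasawaAlgebra

namespace Summit.BirchSwinnertonDyer.BirchSwinnertonDyer.Theorems

/-! ## §1 `Λ`-algebra: Weierstrass degree `≤ 2` and the factorisation-free squeeze -/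

section Algebra

variable (p : ℕ) [hp : Fact p.Prime]

/-- A reducible MONIC QUADRATIC over `ℤ_p` with both lower coefficients in `𝔪 = (p)` and non-zero constant
term splits as `(T − α)(T − β)` with `α, β ∈ pℤ_p ∖ {0}`. [folklore] -/
theorem exists_eq_X_sub_C_mul_X_sub_C_of_not_irreducible {P : Polynomial ℤ_[p]} (hmon : P.Monic)
    (hdeg : P.natDegree = 2) (h0 : (p : ℤ_[p]) ∣ P.coeff 0) (h1 : (p : ℤ_[p]) ∣ P.coeff 1)
    (h00 : P.coeff 0 ≠ 0) (hirr : ¬ Irreducible P) :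
    ∃ α β : ℤ_[p], (p : ℤ_[p]) ∣ α ∧ (p : ℤ_[p]) ∣ β ∧ α ≠ 0 ∧ β ≠ 0 ∧
      P = (Polynomial.X - Polynomial.C α) * (Polynomial.X - Polynomial.C β) := by
  have hP0 : P ≠ 0 := hmon.ne_zero
  have hnu : ¬ IsUnit P := by
    rw [hmon.isUnit_iff]; intro h1'; rw [h1', Polynomial.natDegree_one] at hdeg; exact absurd hdeg (by norm_num)
  have hfac : ∃ a b : Polynomial ℤ_[p], P = a * b ∧ ¬ IsUnit a ∧ ¬ IsUnit b := by
    by_contra hcon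
    refine hirr ⟨hnu, ?_⟩
    intro a b hab
    by_contra h'
    exact hcon ⟨a, b, hab, fun ha => h' (Or.inl ha), fun hb => h' (Or.inr hb)⟩
  obtain ⟨a, b, hab, ha, hb⟩ := hfac
  have ha0 : a ≠ 0 := by rintro rfl; exact hP0 (by rw [hab, zero_mul])
  have hb0 : b ≠ 0 := by rintro rfl; exact hP0 (by rw [hab, mul_zero])
  have hdegab : a.natDegree + b.natDegree = 2 := by
    rw [← Polynomial.natDegree_mul ha0 hb0, ← hab, hdeg]
  have hlc : a.leadingCoeff * b.leadingCoeff = 1 := by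
    rw [← Polynomial.leadingCoeff_mul, ← hab]; exact hmon
  -- neither factor is constant
  have hda : a.natDegree ≠ 0 := by
    intro hda
    apply ha
    rw [Polynomial.eq_C_of_natDegree_eq_zero hda]
    refine Polynomial.isUnit_C.mpr (IsUnit.of_mul_eq_one b.leadingCoeff ?_)
    have : a.leadingCoeff = a.coeff 0 := by rw [Polynomial.leadingCoeff, hda]
    rw [← this]; exact hlc
  have hdb : b.natDegree ≠ 0 := by
    intro hdb
    apply hb
    rw [Polynomial.eq_C_of_natDegree_eq_zero hdb]
    refine Polynomial.isUnit_C.mpr (IsUnit.of_mul_eq_one a.leadingCoeff ?_)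
    have : b.leadingCoeff = b.coeff 0 := by rw [Polynomial.leadingCoeff, hdb]
    rw [← this, mul_comm]; exact hlc
  have hda1 : a.natDegree = 1 := by omega
  have hdb1 : b.natDegree = 1 := by omega
  -- `a = a₁ T + a₀`, `b = b₁ T + b₀`, `a₁ b₁ = 1`
  set a₁ := a.coeff 1 with ha₁
  set a₀ := a.coeff 0 with ha₀
  set b₁ := b.coeff 1 with hb₁
  set b₀ := b.coeff 0 with hb₀
  have hea : a = Polynomial.C a₁ * Polynomial.X + Polynomial.C a₀ :=
    Polynomial.eq_X_add_C_of_natDegree_le_one hda1.le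
  have heb : b = Polynomial.C b₁ * Polynomial.X + Polynomial.C b₀ :=
    Polynomial.eq_X_add_C_of_natDegree_le_one hdb1.le
  have hlc' : a₁ * b₁ = 1 := by
    have hla : a.leadingCoeff = a₁ := by rw [Polynomial.leadingCoeff, hda1]
    have hlb : b.leadingCoeff = b₁ := by rw [Polynomial.leadingCoeff, hdb1]
    rw [← hla, ← hlb]; exact hlc
  have hexp : P = Polynomial.C (a₁ * b₁) * Polynomial.X ^ 2 + Polynomial.C (a₁ * b₀ + a₀ * b₁) * Polynomial.X +
      Polynomial.C (a₀ * b₀) := by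
    rw [hab, hea, heb]; simp only [map_add, map_mul]; ring
  have hc0 : P.coeff 0 = a₀ * b₀ := by
    rw [hexp]
    simp only [Polynomial.coeff_add, Polynomial.coeff_C_mul_X_pow, Polynomial.coeff_C_mul_X,
      Polynomial.coeff_C_zero]
    norm_num
  have hc1 : P.coeff 1 = a₁ * b₀ + a₀ * b₁ := by
    rw [hexp]
    simp only [Polynomial.coeff_add, Polynomial.coeff_C_mul_X_pow, Polynomial.coeff_C_mul_X,
      Polynomial.coeff_C]
    norm_num
  refine ⟨-(a₀ * b₁), -(b₀ * a₁), ?_, ?_, ?_, ?_, ?_⟩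
  · -- `α + β = -(coeff 1 P) ∈ (p)` and `α β = coeff 0 P ∈ (p)`; `(p)` is prime
    have hprod : (p : ℤ_[p]) ∣ (a₀ * b₁) * (b₀ * a₁) := by
      have : (a₀ * b₁) * (b₀ * a₁) = a₀ * b₀ * (a₁ * b₁) := by ring
      rw [this, hlc', mul_one, ← hc0]; exact h0
    have hsum : (p : ℤ_[p]) ∣ a₀ * b₁ + b₀ * a₁ := by
      have : a₀ * b₁ + b₀ * a₁ = P.coeff 1 := by rw [hc1]; ring
      rw [this]; exact h1
    rcases PadicInt.prime_p.dvd_or_dvd hprod with h | h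
    · exact (dvd_neg).mpr h
    · -- `p ∣ b₀ a₁`, hence `p ∣ a₀ b₁ = sum - b₀ a₁`
      have : a₀ * b₁ = (a₀ * b₁ + b₀ * a₁) - b₀ * a₁ := by ring
      rw [dvd_neg, this]; exact dvd_sub hsum h
  · have hprod : (p : ℤ_[p]) ∣ (b₀ * a₁) * (a₀ * b₁) := by
      have : (b₀ * a₁) * (a₀ * b₁) = a₀ * b₀ * (a₁ * b₁) := by ring
      rw [this, hlc', mul_one, ← hc0]; exact h0
    have hsum : (p : ℤ_[p]) ∣ b₀ * a₁ + a₀ * b₁ := by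
      have : b₀ * a₁ + a₀ * b₁ = P.coeff 1 := by rw [hc1]; ring
      rw [this]; exact h1
    rcases PadicInt.prime_p.dvd_or_dvd hprod with h | h
    · exact (dvd_neg).mpr h
    · have : b₀ * a₁ = (b₀ * a₁ + a₀ * b₁) - a₀ * b₁ := by ring
      rw [dvd_neg, this]; exact dvd_sub hsum h
  · -- `α ≠ 0`: `α β = coeff 0 P ≠ 0`
    intro hα
    apply h00
    have hu : IsUnit b₁ := IsUnit.of_mul_eq_one a₁ (by rw [mul_comm]; exact hlc')
    have ha00 : a₀ = 0 := by
      rcases mul_eq_zero.mp (neg_eq_zero.mp hα) with h | h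
      · exact h
      · exact absurd h hu.ne_zero
    rw [hc0, ha00, zero_mul]
  · intro hβ
    apply h00
    have hu : IsUnit a₁ := IsUnit.of_mul_eq_one b₁ hlc'
    have hb00 : b₀ = 0 := by
      rcases mul_eq_zero.mp (neg_eq_zero.mp hβ) with h | h
      · exact h
      · exact absurd h hu.ne_zero
    rw [hc0, hb00, mul_zero]
  · -- the identity `(a₁T + a₀)(b₁T + b₀) = (T + a₀b₁)(T + b₀a₁)` given `a₁b₁ = 1`
    have hC : Polynomial.C a₁ * Polynomial.C b₁ = (1 : Polynomial ℤ_[p]) := by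
      rw [← map_mul, hlc', map_one]
    rw [hab, hea, heb]
    simp only [map_neg, map_mul, sub_neg_eq_add]
    linear_combination (Polynomial.X ^ 2 - Polynomial.C a₀ * Polynomial.C b₀) * hC

/-- **THE FACTORISATION-FREE FUNCTIONAL-EQUATION SQUEEZE in `ℤ_p⟦T⟧`** (`p ≠ 2`). If `T^r ∣ g ∣ L`,
`(ι g) = (g)`, `p ∣ coeff_r g` (ONE factor of `p`), `coeff_r L ≠ 0` and `coeff_{r+2} L ∈ ℤ_pˣ`, then
`(g) = (L)`. (Weierstrass preparation of `L/T^r`: distinguished part of degree `≤ 2`; degrees `0` and `1`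
contradict the factor of `p` / the functional equation; degree `2` is part 1's irreducible-or-split
squeeze.) [cite: Washington1997, §7.1 Thm. 7.3 and §13.2] [cite: KimBD2008MRL, §1 p. 83] -/
theorem span_singleton_eq_of_invol_of_unitCoeff (hp2 : p ≠ 2) {r : ℕ} {g L : IwasawaAlgebra p}
    (hXg : (PowerSeries.X : IwasawaAlgebra p) ^ r ∣ g) (hgL : g ∣ L)
    (hι : Ideal.map (invol p) (Ideal.span {g}) = Ideal.span {g})
    (hcoef : (p : ℤ_[p]) ∣ PowerSeries.coeff r g) (hL0 : PowerSeries.coeff r L ≠ 0)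
    (hL2 : ¬ (p : ℤ_[p]) ∣ PowerSeries.coeff (r + 2) L) :
    Ideal.span {g} = Ideal.span {L} := by
  obtain ⟨g', rfl⟩ := hXg
  obtain ⟨m, hm⟩ := hgL
  set M : IwasawaAlgebra p := g' * m with hMdef
  have hLM : L = PowerSeries.X ^ r * M := by rw [hm, hMdef, mul_assoc]
  have hX0 : (PowerSeries.X : IwasawaAlgebra p) ^ r ≠ 0 := pow_ne_zero _ PowerSeries.X_ne_zero
  have hg'M : g' ∣ M := ⟨m, rfl⟩
  -- coefficients of `M`
  have hM0 : PowerSeries.constantCoeff M ≠ 0 := by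
    rw [hLM, PowerSeries.coeff_X_pow_mul', if_pos le_rfl, Nat.sub_self,
      PowerSeries.coeff_zero_eq_constantCoeff] at hL0
    exact hL0
  have hM2 : ¬ (p : ℤ_[p]) ∣ PowerSeries.coeff 2 M := by
    rw [hLM, PowerSeries.coeff_X_pow_mul', if_pos (Nat.le_add_right r 2), Nat.add_sub_cancel_left] at hL2
    exact hL2
  -- `p ∣ g'(0)`, so `g'` is not a unit and `p ∣ M(0)`
  have hcoef' : (p : ℤ_[p]) ∣ PowerSeries.constantCoeff g' := by
    rw [PowerSeries.coeff_X_pow_mul', if_pos le_rfl, Nat.sub_self,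
      PowerSeries.coeff_zero_eq_constantCoeff] at hcoef
    exact hcoef
  have hnu : ¬ IsUnit g' := by
    intro hgu
    rw [PowerSeries.isUnit_iff_constantCoeff] at hgu
    obtain ⟨t, ht⟩ := hcoef'
    rw [ht] at hgu
    exact PadicInt.prime_p.not_unit (isUnit_of_mul_isUnit_left hgu)
  have hpM0 : (p : ℤ_[p]) ∣ PowerSeries.constantCoeff M := by
    rw [hMdef, map_mul]; exact hcoef'.mul_right _
  -- `(g')` is `ι`-stable
  have hιX : Associated (invol p PowerSeries.X ^ r) ((PowerSeries.X : IwasawaAlgebra p) ^ r) :=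
    (associated_invol_X p).pow_pow
  have hιX0 : invol p PowerSeries.X ^ r ≠ 0 := fun h0 => hX0 (hιX.eq_zero_iff.mp h0)
  have hιg : Associated (invol p g') g' := by
    rw [Ideal.map_span, Set.image_singleton, map_mul, map_pow] at hι
    exact (Ideal.span_singleton_eq_span_singleton.mp hι).of_mul_left hιX hιX0
  -- Weierstrass preparation of `M`
  have hres2 : PowerSeries.coeff 2 (M.map (IsLocalRing.residue ℤ_[p])) ≠ 0 := by
    rw [PowerSeries.coeff_map]
    intro h0
    apply hM2
    rw [IsLocalRing.residue_eq_zero_iff, PadicInt.maximalIdeal_eq_span_p, Ideal.mem_span_singleton] at h0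
    exact h0
  have hMres : M.map (IsLocalRing.residue ℤ_[p]) ≠ 0 := fun h0 => hres2 (by rw [h0, map_zero])
  obtain ⟨P, h, H⟩ := PowerSeries.exists_isWeierstrassFactorization hMres
  have hPdist := H.isDistinguishedAt
  have hPmon : P.Monic := hPdist.monic
  have hh : IsUnit h := H.isUnit
  have hMeq : M = (P : IwasawaAlgebra p) * h := H.eq_mul
  have hdeg : P.natDegree ≤ 2 := by
    rw [H.natDegree_eq_toNat_order_map]
    exact ENat.toNat_le_of_le_coe (PowerSeries.order_le 2 hres2)
  -- `g' ∣ h · P`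
  have hg'P : g' ∣ h * (P : IwasawaAlgebra p) := by rw [mul_comm, ← hMeq]; exact hg'M
  -- the lower coefficients of `P` lie in `(p)`; `P(0) ≠ 0`
  have hPcoef : ∀ {n : ℕ}, n < P.natDegree → (p : ℤ_[p]) ∣ P.coeff n := by
    intro n hn
    have hmem := hPdist.mem hn
    rwa [PadicInt.maximalIdeal_eq_span_p, Ideal.mem_span_singleton] at hmem
  have hPcoe0 : PowerSeries.constantCoeff (P : IwasawaAlgebra p) = P.coeff 0 := by
    rw [← PowerSeries.coeff_zero_eq_constantCoeff_apply, Polynomial.coeff_coe]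
  have hP00 : P.coeff 0 ≠ 0 := by
    intro h0
    apply hM0
    rw [hMeq, map_mul, hPcoe0, h0, zero_mul]
  have hPne : (P : IwasawaAlgebra p) ≠ 0 := fun h0 => hPmon.ne_zero (by exact_mod_cast h0)
  -- the final bookkeeping: `g' ~ P` gives `(T^r g') = (L)`
  have hconclude : Associated g' (P : IwasawaAlgebra p) →
      Ideal.span {PowerSeries.X ^ r * g'} = Ideal.span {L} := by
    intro hgP
    rw [hLM, hMeq, Ideal.span_singleton_eq_span_singleton]
    exact (hgP.trans (associated_mul_unit_right (P : IwasawaAlgebra p) h hh)).mul_left _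
  -- case analysis on the Weierstrass degree `d ≤ 2`
  rcases Nat.lt_or_ge P.natDegree 1 with hd | hd1
  · -- degree 0: `P = 1`, `M = h` is a unit, so `g'` is a unit — contradiction
    exfalso
    have hP1 : P = 1 := Polynomial.eq_one_of_monic_natDegree_zero hPmon (by omega)
    have hMu : IsUnit M := by rw [hMeq, hP1, Polynomial.coe_one, one_mul]; exact hh
    exact hnu (isUnit_of_dvd_unit hg'M hMu)
  rcases Nat.lt_or_ge P.natDegree 2 with hd2 | hd2
  · -- degree 1: `P = T - a`, `a ∈ pℤ_p ∖ {0}` — excluded by the functional equation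
    exfalso
    have hd1' : P.natDegree = 1 := by omega
    set a : ℤ_[p] := -P.coeff 0 with ha
    have hPa : P = Polynomial.X - Polynomial.C a := by
      rw [hPmon.eq_X_add_C hd1', ha, map_neg, sub_neg_eq_add]
    have hpa : (p : ℤ_[p]) ∣ a := (dvd_neg).mpr (hPcoef (by omega))
    have ha0 : a ≠ 0 := neg_ne_zero.mpr hP00
    have hcoe : (P : IwasawaAlgebra p) = PowerSeries.X - PowerSeries.C a := by
      rw [hPa]; simp [sub_eq_add_neg, Polynomial.coe_add]
    rw [hcoe] at hg'P
    rcases isUnit_or_associated_of_dvd_unit_mul_prime hh (prime_X_sub_C p hpa) hg'P with hu' | hassoc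
    · exact hnu hu'
    · exact not_associated_invol_X_sub_C p hp2 hpa ha0
        (((hassoc.map (invol p : IwasawaAlgebra p →* IwasawaAlgebra p)).symm.trans hιg).trans hassoc)
  -- degree 2
  have hd2' : P.natDegree = 2 := le_antisymm hdeg hd2
  by_cases hirr : Irreducible P
  · -- irreducible: `P` is prime in `Λ`, `g' ∈ {1, P}·Λˣ`
    have hPprime : Prime P := UniqueFactorizationMonoid.irreducible_iff_prime.mp hirr
    haveI : (Ideal.span {P}).IsPrime := (Ideal.span_singleton_prime hPmon.ne_zero).mpr hPprime
    have hprimeΛ : Prime (P : IwasawaAlgebra p) :=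
      (Ideal.span_singleton_prime hPne).mp (span_coe_isPrime_of_dvd hPdist (q := P) (dvd_refl P))
    rcases isUnit_or_associated_of_dvd_unit_mul_prime hh hprimeΛ hg'P with hu' | hassoc
    · exact absurd hu' hnu
    · exact hconclude hassoc
  · -- reducible: `P = (T - α)(T - β)`, the split squeeze of part 1
    obtain ⟨α, β, hα, hβ, hα0, hβ0, hPab⟩ :=
      exists_eq_X_sub_C_mul_X_sub_C_of_not_irreducible p hPmon hd2' (hPcoef (by omega))
        (hPcoef (by omega)) hP00 hirr
    have hcoe : (P : IwasawaAlgebra p) =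
        (PowerSeries.X - PowerSeries.C α) * (PowerSeries.X - PowerSeries.C β) := by
      rw [hPab, Polynomial.coe_mul]; simp [sub_eq_add_neg, Polynomial.coe_add]
    have hLs : L = h * PowerSeries.X ^ r *
        ((PowerSeries.X - PowerSeries.C α) * (PowerSeries.X - PowerSeries.C β)) := by
      rw [hLM, hMeq, hcoe]; ring
    exact span_singleton_eq_of_invol_of_feShape p hp2 hh hα hβ hα0 hβ0 hLs (dvd_mul_right _ _)
      ⟨m, hm⟩ hι hcoef

end Algebra



end Summit.BirchSwinnertonDyer.BirchSwinnertonDyer.Theorems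

end
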